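import Summits.BirchSwinnertonDyer.BirchSwinnertonDyer.Theorems.ResidualThetaTransportAtTwoHeckeThetaPartnerAdicAtTwoTypeOneGrossencharakter
import Summits.BirchSwinnertonDyer.BirchSwinnertonDyer.Theorems.ResidualThetaTransportAtTwoHeckeThetaPartnerAdicAtTwoTeichmullerTwist
import Summits.BirchSwinnertonDyer.BirchSwinnertonDyer.Theorems.ResidualThetaTransportAtTwoHeckeThetaPartnerAdicAtTwoUnitCharacter
import Summits.BirchSwinnertonDyer.BirchSwinnertonDyer.Theorems.ResidualThetaTransportAtTwoHeckeThetaPartnerAdicAtTwoQuadField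
import Summits.BirchSwinnertonDyer.BirchSwinnertonDyer.Theorems.ResidualThetaTransportAtTwoHeckeThetaPartnerAdicAtTwoCubicClosure
import Summits.BirchSwinnertonDyer.BirchSwinnertonDyer.Theorems.ResidualThetaTransportAtTwoHeckeThetaPartnerAdicAtTwoRamifiedAtTwo
import Summits.BirchSwinnertonDyer.BirchSwinnertonDyer.Theorems.ResidualThetaTransportAtTwoHeckeThetaPartnerAdicAtTwoCharacterAtTwo
import Summits.BirchSwinnertonDyer.BirchSwinnertonDyer.Theorems.ResidualThetaTransportAtTwoHeckeThetaPartnerAdicAtTwoMatchingAtTwo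
import Summits.BirchSwinnertonDyer.BirchSwinnertonDyer.Theorems.ResidualThetaTransportAtTwoHeckeThetaPartnerAdicAtTwoUnitValues
import Summits.BirchSwinnertonDyer.BirchSwinnertonDyer.Theorems.ResidualThetaTransportAtTwoHeckeThetaPartnerAdicAtTwoNebentypus
import Summits.BirchSwinnertonDyer.BirchSwinnertonDyer.Theorems.ResidualThetaTransportAtTwoHeckeThetaPartnerAdicAtTwoTraceCongruence
import Literature.NumberTheory.QuadraticFields.FundamentalDiscriminant
import Literature.NumberTheory.EllipticCurves.NoEverywhereGoodReductionRat
import Literature.FieldTheory.AlgClosed.PadicAlgClEquivComplex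
import HarnessLib

/-!
# The Größencharakter of the `2`-adic theta partner (assembly of the arithmetic side)

Route `ResidualThetaTransportAtTwo`, crux K0⁺ `HeckeThetaPartnerAdicAtTwo` (stmt-BirchSwinnertonDyer-20690),
helper §G1 of the line "proof from print"; THEOREMS ONLY.  `exists_grossencharakter_partner`: for a
globally minimal `W/ℚ`, good supersingular at `2`, `Δ_W < 0`: an imaginary quadratic `k = ℚ(√Δ_W)` (`2`
inert, no ideal of norm `2`), `σ : k → ℂ`, an odd `t` whose primes divide `Δ_min(W)`, `e : ℚ̄₂ ≃ ℂ` and a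
Größencharakter `ψ mod (t)` of type `σ` with trivial Nebentypus such that
`‖e⁻¹(∑_{Nw = ℓ} ψ(w)) - a_ℓ(W)‖ < 1` for every odd prime `ℓ ∤ Δ_min(W)`.  Composition of the helpers
C1, B, C2, C3, R2, D2, D1, E1′, E1, hU, E2, H, AP of the line (see their files) with
`CubicFields.exists_resolventClosure` / `cubicRayClassFunction_spec`.
-/

set_option autoImplicit false
set_option linter.dupNamespace false

noncomputable section

open scoped NumberField Pointwise
open NumberField IsDedekindDomain Polynomial Module WeierstrassCurve
open Literature.NumberTheory.GaloisRepresentations Literature.NumberTheory.LFunctions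
  Literature.NumberTheory.CubicFields Literature.NumberTheory.NumberFields
  Literature.NumberTheory.EllipticCurves Literature.NumberTheory.EllipticCurves.ModularForms
  Literature.NumberTheory.QuadraticFields Literature.NumberTheory.QuadraticFields.Quadratic
  Literature.NumberTheory.EllipticCurves.Rank1Residual

namespace Summit.BirchSwinnertonDyer.BirchSwinnertonDyer.Theorems.HeckeThetaPartner

/-- **The arithmetic half of K0⁺.**  See the module docstring. [cite: SerreInventiones1972, §5.4] -/
theorem exists_grossencharakter_partner (W : WeierstrassCurve ℚ) [W.IsElliptic] [W.IsGloballyMinimal]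
    (hss : GoodSS W 2) (hΔ : W.Δ < 0) :
    ∃ (k : Type) (_ : Field k) (_ : NumberField k) (σ : k →+* ℂ) (t : ℤ)
      (ψ : HeightOneSpectrum (𝓞 k) → ℂ) (e : PadicAlgCl 2 ≃+* ℂ),
      Module.finrank ℚ k = 2 ∧ IsTotallyComplex k ∧ t ≠ 0 ∧ discr k ∣ t ∧
      (∀ p : ℕ, p.Prime → (p : ℤ) ∣ t → (p : ℤ) ∣ minimalDiscriminantInt W) ∧ Odd t ∧
      (∀ I : Ideal (𝓞 k), Ideal.absNorm I ≠ 2) ∧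
      IsGrossencharakter (Ideal.span {(t : 𝓞 k)}) (embType σ) (embTypeConj σ) ψ ∧
      (∀ n : ℕ, Odd n → n.Coprime ((discr k).natAbs * Ideal.absNorm (Ideal.span {(t : 𝓞 k)})) →
        idealPow k ψ (Ideal.span {(n : 𝓞 k)}) = (jacobiSym (discr k) n : ℂ) * (n : ℂ) ^ (2 - 1)) ∧
      (∀ ℓ : ℕ, ℓ.Prime → ℓ ≠ 2 → ¬ (ℓ : ℤ) ∣ minimalDiscriminantInt W →
        ‖e.symm (∑ᶠ (w : HeightOneSpectrum (𝓞 k)) (_ : Ideal.absNorm w.asIdeal = ℓ), ψ w) -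
          (W.frobeniusTrace ℓ : PadicAlgCl 2)‖ < 1) := by
  classical
  set Δ : ℤ := minimalDiscriminantInt W with hΔdef
  have hΔ8 : Δ % 8 = 5 :=
    Summit.BirchSwinnertonDyer.Rank1Residual.Supersingular.minimalDiscriminantInt_emod_eight_eq_five_of_goodSS_two W hss
  have hΔneg : Δ < 0 := by
    have h := cast_minimalDiscriminantInt W
    have : ((minimalDiscriminantInt W : ℤ) : ℚ) < 0 := by rw [h]; exact hΔ
    exact_mod_cast this
  have hΔ0 : Δ ≠ 0 := hΔneg.ne
  have hΔodd : Odd Δ := by rw [Int.odd_iff]; omega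
  set A : ℤ := (integralModelInt W).b₂ with hA
  set B : ℤ := 8 * (integralModelInt W).b₄ with hB
  set Cc : ℤ := 16 * (integralModelInt W).b₆ with hCc
  have hirr : Irreducible (MonicCubic.polyQ A B Cc) := irreducible_twoDivisionCubic_of_goodSS W hss
  haveI : Fact (Irreducible (MonicCubic.polyQ A B Cc)) := ⟨hirr⟩
  obtain ⟨⟨s, hs⟩, ⟨r, hr⟩⟩ :=
    Summit.BirchSwinnertonDyer.Rank1Residual.Supersingular.even_a₁_and_odd_a₃_of_goodSS_two W hss.1 hss.2
  have hA4 : 4 ∣ A := ⟨s ^ 2 + (integralModelInt W).a₂, by rw [hA, WeierstrassCurve.b₂, hs]; ring⟩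
  have hB16 : 16 ∣ B := ⟨(integralModelInt W).a₄ + s * (integralModelInt W).a₃, by
    rw [hB, WeierstrassCurve.b₄, hs]; ring⟩
  have hb₆odd : Odd (integralModelInt W).b₆ :=
    ⟨2 * (r ^ 2 + r) + 2 * (integralModelInt W).a₆, by rw [WeierstrassCurve.b₆, hr]; ring⟩
  have hdisc : MonicCubic.disc A B Cc = 256 * Δ := disc_twoDivisionCubic W
  obtain ⟨k, _, _, hk2, htc, hgal, ⟨m, hΔm⟩, hdk8, ⟨δ, hδ⟩, hp2ℕ, hno2⟩ :=
    exists_imaginaryQuadraticField_sq hΔneg hΔ8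
  haveI := htc; haveI := hgal
  have h2cast : ((2 : ℕ) : 𝓞 k) = 2 := Nat.cast_ofNat
  have hp2 : (Ideal.span {(2 : 𝓞 k)}).IsPrime := by rw [← h2cast]; exact hp2ℕ
  have hπ2 : Prime (2 : 𝓞 k) := (Ideal.span_singleton_prime two_ne_zero).mp hp2
  have hP20 : Ideal.span {(2 : 𝓞 k)} ≠ ⊥ := by rw [Ne, Ideal.span_singleton_eq_bot]; exact two_ne_zero
  haveI hP2max : (Ideal.span {(2 : 𝓞 k)}).IsMaximal := hp2.isMaximal hP20
  let v₂ : HeightOneSpectrum (𝓞 k) := ⟨Ideal.span {(2 : 𝓞 k)}, hp2, hP20⟩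
  have hv₂ : v₂.asIdeal = Ideal.span {(2 : 𝓞 k)} := rfl
  set d : ℤ := discr k with hddef
  have hd4 : d % 4 = 1 := by omega
  have hd0 : d ≠ 0 := by intro h; rw [h] at hdk8; norm_num at hdk8
  have hdodd : ¬ (2 : ℤ) ∣ d := by omega
  have hdΔ : d ∣ Δ := ⟨m ^ 2, hΔm⟩
  have hdneg : d < 0 := by
    by_contra h
    exact absurd hΔneg (not_lt.mpr (hΔm ▸ mul_nonneg (not_lt.mp h) (sq_nonneg m)))
  have hdsf : Squarefree d := by
    rcases isFundamentalDiscriminant_discr (K := k) hk2 with ⟨-, h, -⟩ | ⟨h4, -, -⟩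
    · exact h
    · exfalso; omega
  set Kh := AdjoinRoot (MonicCubic.polyQ A B Cc) with hKh
  have hK3 : Module.finrank ℚ Kh = 3 := finrank_adjoinRoot_polyQ A B Cc
  obtain ⟨i, hi0, hidisc⟩ := exists_disc_eq_sq_mul_discr A B Cc
  obtain ⟨f, hf⟩ : ∃ f : ℤ, discr Kh = d * f ^ 2 := by
    refine exists_eq_mul_sq_of_squarefree hdsf hi0 (n := 16 * m) ?_
    have : discr Kh * i ^ 2 = 256 * Δ := by rw [← hdisc, hidisc]; ring
    rw [this, hΔm]; ring
  have hf0 : f ≠ 0 := by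
    rintro rfl
    exact NumberField.discr_ne_zero Kh (by rw [hf]; ring)
  obtain ⟨L, hLfd, h3, hLab, hLgal, -, ⟨ι⟩, hgen⟩ := exists_resolventClosure hk2 Kh hK3 hf0 hf
  haveI := hLfd; haveI := hLab; haveI := hLgal
  haveI : NumberField L := NumberField.of_module_finite k L
  have hKG : ¬ IsGalois ℚ Kh := not_isGalois_of_discr_eq_mul_sq hk2 Kh hK3 hf0 hf
  have hcard3 : Nat.card (L ≃ₐ[k] L) = 3 := by rw [IsGalois.card_aut_eq_finrank, h3]
  obtain ⟨χ, hχ⟩ := exists_injective_character L hcard3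
  set d₀ : ℤ := 2 * Δ with hd₀
  have hd₀0 : (d₀ : 𝓞 k) ≠ 0 := by
    have : d₀ ≠ 0 := mul_ne_zero two_ne_zero hΔ0
    exact_mod_cast this
  have hTfin : {v : HeightOneSpectrum (𝓞 k) | Ideal.span {(d₀ : 𝓞 k)} ≤ v.asIdeal}.Finite :=
    finite_setOf_le_asIdeal (by rw [Ne, Ideal.span_singleton_eq_bot]; exact hd₀0)
  set T : Finset (HeightOneSpectrum (𝓞 k)) := hTfin.toFinset with hTdef
  have hmemT : ∀ v : HeightOneSpectrum (𝓞 k), v ∈ T ↔ (d₀ : 𝓞 k) ∈ v.asIdeal := by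
    intro v; rw [hTdef, Set.Finite.mem_toFinset, Set.mem_setOf_eq, Ideal.span_singleton_le_iff_mem]
  have copr_false : ∀ (v : HeightOneSpectrum (𝓞 k)) (a b : ℤ), IsCoprime a b →
      (a : 𝓞 k) ∈ v.asIdeal → (b : 𝓞 k) ∈ v.asIdeal → False := by
    intro v a b hab ha hb
    obtain ⟨u, w, h⟩ := hab
    have h1 : ((u * a + w * b : ℤ) : 𝓞 k) ∈ v.asIdeal := by
      push_cast
      exact v.asIdeal.add_mem (v.asIdeal.mul_mem_left _ ha) (v.asIdeal.mul_mem_left _ hb)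
    rw [h, Int.cast_one] at h1
    exact v.isPrime.ne_top ((Ideal.eq_top_iff_one _).mpr h1)
  have hdL : ∀ p : ℕ, p.Prime → (p : ℤ) ∣ discr L → (p : ℤ) ∣ d₀ := by
    intro p hp hpL
    have hpK : (p : ℤ) ∣ discr Kh := dvd_discr_of_dvd_discr_of_iSup_fieldRange_eq_top Kh L hgen hp hpL
    have hp' : Prime (p : ℤ) := Nat.prime_iff_prime_int.mp hp
    have h256 : (p : ℤ) ∣ 256 * Δ := by rw [← hdisc, hidisc]; exact hpK.mul_left _
    rcases hp'.dvd_or_dvd h256 with h | h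
    · have h2 : (p : ℤ) ∣ 2 := hp'.dvd_of_dvd_pow (by norm_num at h ⊢; exact h : (p : ℤ) ∣ 2 ^ 8)
      exact h2.mul_right _
    · exact h.mul_left _
  have hunr : ∀ v : HeightOneSpectrum (𝓞 k), v ∉ T → Algebra.IsUnramifiedIn (𝓞 L) v.asIdeal :=
    fun v hv => isUnramifiedIn_of_intCast_not_mem L hdL v ((hmemT v).not.mp hv)
  obtain ⟨⟨𝔪χ, h𝔪χ0, h𝔪χT, hray⟩, hcube, -⟩ := cubicRayClassFunction_spec L χ hcard3 T hunr
  set ψχ : HeightOneSpectrum (𝓞 k) → ℂ := fun v => if v ∈ T then (0 : ℂ) else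
    (charHecke L χ artinReciprocity_character_holds).valueAtUniformizer v with hψχdef
  have hψχval : ∀ v, v ∉ T → ψχ v = ((χ (galFrob k L v) : ℂˣ) : ℂ) := fun v hv =>
    cubicRayClassFunction_apply_of_not_mem L χ T hunr hv
  obtain ⟨E, hE1, hEmem⟩ : ∃ E : ℕ, 1 ≤ E ∧ ((d₀ : 𝓞 k)) ^ E ∈ 𝔪χ := by
    have hrad : (d₀ : 𝓞 k) ∈ 𝔪χ.radical := by
      rw [Ideal.radical_eq_sInf, Submodule.mem_sInf]
      intro J hJ
      obtain ⟨hJ𝔪, hJprime⟩ := hJ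
      haveI := hJprime
      by_cases hJtop : J = ⊤
      · rw [hJtop]; exact Submodule.mem_top
      have hJ0 : J ≠ ⊥ := fun h => h𝔪χ0 (le_bot_iff.mp (h ▸ hJ𝔪))
      let vJ : HeightOneSpectrum (𝓞 k) := ⟨J, hJprime, hJ0⟩
      exact (hmemT vJ).mp (h𝔪χT vJ hJ𝔪)
    obtain ⟨E, hE⟩ := hrad
    exact ⟨E + 1, by omega, by rw [pow_succ]; exact 𝔪χ.mul_mem_right _ hE⟩
  set t : ℤ := d * Δ ^ E with htdef
  have ht0 : t ≠ 0 := mul_ne_zero hd0 (pow_ne_zero _ hΔ0)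
  have htodd : Odd t := by
    rw [htdef]; exact (Int.odd_iff.mpr (by omega)).mul (hΔodd.pow)
  have ht3 : 3 ≤ |t| := by
    rw [htdef, abs_mul, abs_pow]
    have h1 : 3 ≤ |d| := by
      have := Int.emod_emod_of_dvd d (by norm_num : (4 : ℤ) ∣ 8)
      rw [abs_of_neg hdneg]; omega
    have h2 : 1 ≤ |Δ| ^ E := one_le_pow₀ (Int.one_le_abs hΔ0)
    nlinarith
  have htprimes : ∀ p : ℕ, p.Prime → (p : ℤ) ∣ t → (p : ℤ) ∣ Δ := by
    intro p hp hpt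
    have hp' : Prime (p : ℤ) := Nat.prime_iff_prime_int.mp hp
    rcases hp'.dvd_or_dvd hpt with h | h
    · exact h.trans hdΔ
    · exact hp'.dvd_of_dvd_pow h
  set 𝔪 : Ideal (𝓞 k) := Ideal.span {(t : 𝓞 k)} with h𝔪def
  have ht0' : (t : 𝓞 k) ≠ 0 := by exact_mod_cast ht0
  have h𝔪0 : 𝔪 ≠ ⊥ := by rw [h𝔪def, Ne, Ideal.span_singleton_eq_bot]; exact ht0'
  have h𝔪P : IsCoprime 𝔪 (Ideal.span {(2 : 𝓞 k)}) := by
    rw [h𝔪def, Ideal.isCoprime_span_singleton_iff]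
    have ht2 : IsCoprime t 2 :=
      IsCoprime.symm ((Prime.coprime_iff_not_dvd Int.prime_two).mpr (by
        intro h2; have := Int.odd_iff.mp htodd; omega))
    obtain ⟨u, v, huv⟩ := ht2
    exact ⟨u, v, by exact_mod_cast huv⟩
  have hΔmem_of_T : ∀ v ∈ T, v.asIdeal ≠ Ideal.span {(2 : 𝓞 k)} → (Δ : 𝓞 k) ∈ v.asIdeal := by
    intro v hv hv2
    have hd₀v : (d₀ : 𝓞 k) ∈ v.asIdeal := (hmemT v).mp hv
    rw [hd₀, Int.cast_mul] at hd₀v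
    rcases v.isPrime.mem_or_mem hd₀v with h | h
    · exfalso; apply hv2
      have hle : Ideal.span {(2 : 𝓞 k)} ≤ v.asIdeal := by
        rw [Ideal.span_singleton_le_iff_mem]; exact_mod_cast h
      exact (hP2max.eq_of_le v.isPrime.ne_top hle).symm
    · exact h
  have hT𝔪 : ∀ v ∈ T, v.asIdeal ≠ Ideal.span {(2 : 𝓞 k)} → 𝔪 ≤ v.asIdeal := by
    intro v hv hv2
    rw [h𝔪def, Ideal.span_singleton_le_iff_mem, htdef, Int.cast_mul, Int.cast_pow]
    exact v.asIdeal.mul_mem_left _ (v.asIdeal.pow_mem_of_mem (hΔmem_of_T v hv hv2) E hE1)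
  have hle : Ideal.span {(2 : 𝓞 k) ^ E} * 𝔪 ≤ 𝔪χ := by
    rw [h𝔪def, Ideal.span_singleton_mul_span_singleton, Ideal.span_singleton_le_iff_mem]
    have : (2 : 𝓞 k) ^ E * (t : 𝓞 k) = (d : 𝓞 k) * (d₀ : 𝓞 k) ^ E := by
      rw [htdef, hd₀]; push_cast; ring
    rw [this]
    exact 𝔪χ.mul_mem_left _ hEmem
  have hψ3 : ∀ v : HeightOneSpectrum (𝓞 k), v.asIdeal ≠ Ideal.span {(2 : 𝓞 k)} → ¬ 𝔪 ≤ v.asIdeal →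
      ψχ v ^ 3 = 1 := fun v hv2 hv𝔪 => hcube v fun hvT => hv𝔪 (hT𝔪 v hvT hv2)
  obtain ⟨hrootcard, -⟩ := card_roots_ringOfIntegers_eq_three A B Cc L ι
  obtain ⟨θ, hθ⟩ : ∃ θ, θ ∈ ((MonicCubic.poly A B Cc).map (Int.castRingHom (𝓞 L))).roots :=
    Multiset.card_pos_iff_exists_mem.mp (by rw [hrootcard]; norm_num)
  have hθeq : θ ^ 3 + (A : 𝓞 L) * θ ^ 2 + (B : 𝓞 L) * θ + 16 * ((integralModelInt W).b₆ : 𝓞 L) = 0 := by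
    have h := (Polynomial.mem_roots ((MonicCubic.monic_poly A B Cc).map _).ne_zero).mp hθ
    rw [Polynomial.IsRoot.def, Polynomial.eval_map] at h
    have h' : θ ^ 3 + (A : 𝓞 L) * θ ^ 2 + (B : 𝓞 L) * θ + (Cc : 𝓞 L) = 0 := by
      unfold MonicCubic.poly at h
      simp only [Polynomial.eval₂_add, Polynomial.eval₂_mul, Polynomial.eval₂_C, Polynomial.eval₂_X_pow,
        Polynomial.eval₂_X] at h
      simpa only [eq_intCast] using h
    have hC : (Cc : 𝓞 L) = 16 * ((integralModelInt W).b₆ : 𝓞 L) := by rw [hCc]; push_cast; ring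
    rw [hC] at h'
    exact h' 
  have hram : ¬ Algebra.IsUnramifiedIn (𝓞 L) v₂.asIdeal :=
    not_isUnramifiedIn_of_root v₂ hv₂ hdodd θ hA4 hB16 hb₆odd hθeq
  obtain ⟨b₀, hb₀0, hb₀P, hb₀𝔪, hb₀ψ⟩ :=
    exists_idealPow_ne_one_of_not_isUnramifiedIn L χ hχ T hunr hπ2 h𝔪0 h𝔪P hT𝔪 v₂ hv₂ hram
  obtain ⟨e⟩ := PadicAlgCl.nonempty_ringEquiv_complex 2
  obtain ⟨σ⟩ := (inferInstance : Nonempty (k →+* ℂ))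
  obtain ⟨ε, hε, hmatch⟩ :=
    exists_matching_pow hk2 hp2 e σ h𝔪0 h𝔪P ψχ hray hle hψ3 hb₀0 hb₀P hb₀𝔪 hb₀ψ
  set χ' : (L ≃ₐ[k] L) →* ℂˣ := χ ^ ε with hχ'def
  have hχ' : Function.Injective χ' := by
    intro g₁ g₂ h
    rw [hχ'def, MonoidHom.pow_apply, MonoidHom.pow_apply] at h
    have hg : (g₁ * g₂⁻¹) ^ ε = 1 := by
      apply hχ; rw [map_pow, map_mul, map_inv, mul_pow, h, map_one, ← mul_pow, mul_inv_cancel, one_pow]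
    have h3 : (g₁ * g₂⁻¹) ^ 3 = 1 := by rw [← hcard3]; exact pow_card_eq_one'
    have hcop : (ε).Coprime 3 := by rcases hε with rfl | rfl <;> norm_num
    have := pow_gcd_eq_one.mpr ⟨hg, h3⟩
    rw [hcop, pow_one] at this
    exact mul_inv_eq_one.mp this
  set ψχ' : HeightOneSpectrum (𝓞 k) → ℂ := fun v => ψχ v ^ ε with hψχ'def
  have hψχ'val : ∀ v, v ∉ T → ψχ' v = ((χ' (galFrob k L v) : ℂˣ) : ℂ) := by
    intro v hv
    rw [hψχ'def]; simp only
    rw [hψχval v hv, hχ'def, MonoidHom.pow_apply, Units.val_pow_eq_pow_val]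
  have hψχ'eq : ψχ' = fun v => if v ∈ T then (0 : ℂ) else
      (charHecke L χ' artinReciprocity_character_holds).valueAtUniformizer v := by
    funext v
    by_cases hv : v ∈ T
    · rw [hψχ'def]; simp only [hψχdef, if_pos hv]
      rcases hε with h | h <;> simp [h]
    · rw [hψχ'val v hv]
      simp only [if_neg hv]
      rw [charHecke_valueAtUniformizer L χ' _ (hunr v hv)]
  have hδk : (δ : k) ^ 2 = ((Δ : ℤ) : k) := by
    have := congrArg (fun x : 𝓞 k => (x : k)) hδ
    push_cast at this; exact this
  obtain ⟨lam, hlamU, hlamZ⟩ := exists_unitCharacter hk2 σ hΔneg hδk ht3 (Dvd.intro _ rfl)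
  obtain ⟨ψ₀, hψ₀G, hψ₀val⟩ := exists_isGrossencharakter_embType σ lam hlamU
  have hU : ∀ v : HeightOneSpectrum (𝓞 k), ¬ Ideal.span {((2 : ℕ) : 𝓞 k)} ≤ v.asIdeal → ¬ 𝔪 ≤ v.asIdeal →
      ‖e.symm (ψχ' v)‖ = 1 ∧ ‖e.symm (ψ₀ v)‖ = 1 := by
    intro v hv2 hv𝔪
    rw [h2cast] at hv2
    have hv2' : v.asIdeal ≠ Ideal.span {(2 : 𝓞 k)} := fun h => hv2 h.symm.le
    refine ⟨?_, norm_symm_eq_one_of_principal_values hp2 e σ h𝔪0 lam hψ₀val v hv2' hv𝔪⟩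
    have h3 : ψχ' v ^ 3 = 1 := by
      rw [hψχ'def]; simp only; rw [← pow_mul, mul_comm, pow_mul, hψ3 v hv2' hv𝔪, one_pow]
    exact norm_symm_eq_one_of_pow_eq_one e (by norm_num) h3
  have hM : ∀ b : 𝓞 k, b ≠ 0 → b ∉ Ideal.span {((2 : ℕ) : 𝓞 k)} → b - 1 ∈ 𝔪 →
      ‖e.symm (idealPow k ψχ' (Ideal.span {b})) - e.symm (idealPow k ψ₀ (Ideal.span {b}))‖ < 1 := by
    intro b hb0 hbP hb1
    rw [h2cast] at hbP
    have hbu : IsUnit (Ideal.Quotient.mk 𝔪 b) := by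
      have : Ideal.Quotient.mk 𝔪 b = 1 := by
        rw [← map_one (Ideal.Quotient.mk 𝔪), Ideal.Quotient.eq]; exact hb1
      rw [this]; exact isUnit_one
    have hunit1 : hbu.unit = 1 := Units.ext (by
      rw [IsUnit.unit_spec, Units.val_one, ← map_one (Ideal.Quotient.mk 𝔪), Ideal.Quotient.eq]; exact hb1)
    have hψ₀b : idealPow k ψ₀ (Ideal.span {b}) = σ (b : k) := by
      rw [hψ₀val b hb0 hbu, hunit1, map_one, Units.val_one, mul_one]
    have hχb : idealPow k ψχ' (Ideal.span {b}) = idealPow k ψχ (Ideal.span {b}) ^ ε := by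
      rw [hψχ'def]; exact idealPow_pow_fun ψχ ε (by rw [Ne, Ideal.span_singleton_eq_bot]; exact hb0)
    rw [hψ₀b, hχb]
    exact hmatch b hb0 hbP hb1
  have hp2ℕ' : (Ideal.span {((2 : ℕ) : 𝓞 k)}).IsPrime := hp2ℕ
  have h𝔪P' : IsCoprime 𝔪 (Ideal.span {((2 : ℕ) : 𝓞 k)}) := by rw [h2cast]; exact h𝔪P
  obtain ⟨ψ, hψG, hψcong, hψprinc⟩ := exists_isGrossencharakter_congr e hp2ℕ' h𝔪0 h𝔪P' hψ₀G hU hM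
  refine ⟨k, inferInstance, inferInstance, σ, t, ψ, e, hk2, htc, ht0, Dvd.intro _ rfl, fun p hp hpt => htprimes p hp hpt,
    htodd, hno2, hψG, ?_, ?_⟩
  · /- trivial Nebentypus -/
    intro n hn hncop
    have hNt : Ideal.absNorm 𝔪 = (t ^ 2).natAbs := by
      rw [h𝔪def, Ideal.absNorm_span_singleton, show ((t : ℤ) : 𝓞 k) = algebraMap ℤ (𝓞 k) t from by simp,
        Algebra.norm_algebraMap, RingOfIntegers.rank, hk2]
    have hnd : n.Coprime d.natAbs := Nat.Coprime.coprime_mul_right_right hncop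
    have hnt : n.Coprime t.natAbs := by
      have h := Nat.Coprime.coprime_mul_left_right hncop
      rw [hNt, Int.natAbs_pow] at h
      exact (Nat.coprime_pow_right_iff (by norm_num) _ _).mp h
    have hnpos : 0 < n := hn.pos
    have hn0 : (n : 𝓞 k) ≠ 0 := by exact_mod_cast hnpos.ne'
    have hntZ : IsCoprime (n : ℤ) t :=
      Int.isCoprime_iff_gcd_eq_one.mpr (by change (n : ℤ).natAbs.gcd t.natAbs = 1; rw [Int.natAbs_natCast]; exact hnt)
    have hn2Z : IsCoprime (n : ℤ) 2 := by
      refine ((Prime.coprime_iff_not_dvd Int.prime_two).mpr ?_).symm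
      obtain ⟨r, hr⟩ := hn
      intro h2; rw [hr] at h2; push_cast at h2; omega
    have hnΔZ : IsCoprime (n : ℤ) Δ := by
      have h1 : IsCoprime (n : ℤ) (Δ ^ E) := by rw [htdef] at hntZ; exact hntZ.of_mul_right_right
      exact (IsCoprime.pow_right_iff (by omega : 0 < E)).mp h1
    have hnd₀Z : IsCoprime (n : ℤ) d₀ := by rw [hd₀]; exact IsCoprime.mul_right hn2Z hnΔZ
    have hnP : (n : 𝓞 k) ∉ Ideal.span {((2 : ℕ) : 𝓞 k)} := by
      rw [h2cast]
      intro h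
      have h' : ((2 : ℤ) : 𝓞 k) ∣ ((n : ℤ) : 𝓞 k) := by
        have := Ideal.mem_span_singleton.mp h
        simpa using this
      have h2n : (2 : ℤ) ∣ (n : ℤ) := int_dvd_of_coe_dvd hk2 h'
      exact (Prime.coprime_iff_not_dvd Int.prime_two).mp hn2Z.symm h2n
    have hn𝔪 : IsCoprime (Ideal.span {(n : 𝓞 k)}) 𝔪 := by
      rw [h𝔪def, Ideal.isCoprime_span_singleton_iff]
      obtain ⟨u, v, huv⟩ := hntZ
      exact ⟨u, v, by exact_mod_cast huv⟩
    have hTdisc : ∀ v : HeightOneSpectrum (𝓞 k), ((discr k : ℤ) : 𝓞 k) ∈ v.asIdeal → v ∈ T := by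
      intro v hv
      rw [hmemT, hd₀, hΔm]
      have : ((2 * (discr k * m ^ 2) : ℤ) : 𝓞 k) = (2 * m ^ 2 : 𝓞 k) * ((discr k : ℤ) : 𝓞 k) := by
        push_cast; ring
      rw [this]
      exact v.asIdeal.mul_mem_left _ hv
    have hnT : ∀ v ∈ T, ((n : ℤ) : 𝓞 k) ∉ v.asIdeal := by
      intro v hv hnv
      exact copr_false v _ _ hnd₀Z hnv ((hmemT v).mp hv)
    have hχn : idealPow k ψχ (Ideal.span {(n : 𝓞 k)}) = 1 := by
      have h := idealPow_span_intCast_eq_one L hk2 h3 hKG ι χ T hunr hTdisc (a := (n : ℤ))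
        (by exact_mod_cast hnpos.ne') hnT
      rw [Int.cast_natCast] at h
      exact h
    have hχ'n : idealPow k ψχ' (Ideal.span {(n : 𝓞 k)}) = 1 := by
      rw [hψχ'def, idealPow_pow_fun ψχ ε (by rw [Ne, Ideal.span_singleton_eq_bot]; exact hn0), hχn, one_pow]
    have hnu : IsUnit (Ideal.Quotient.mk 𝔪 (n : 𝓞 k)) := isUnit_mk_of_isCoprime hn𝔪
    have hnu' : IsUnit (Ideal.Quotient.mk (Ideal.span {(t : 𝓞 k)}) ((n : ℤ) : 𝓞 k)) := by
      rw [Int.cast_natCast]; exact hnu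
    obtain ⟨huZ, hlamn⟩ := hlamZ (n : ℤ) hnu'
    have hu : IsUnit (n : ZMod d.natAbs) := (ZMod.isUnit_iff_coprime n d.natAbs).mpr hnd
    have hψ₀n : idealPow k ψ₀ (Ideal.span {(n : 𝓞 k)}) = (n : ℂ) * ((discrChar d hu.unit : ℤˣ) : ℤ) := by
      rw [hψ₀val (n : 𝓞 k) hn0 hnu]
      have hσn : σ ((n : 𝓞 k) : k) = (n : ℂ) := by simp
      have hunits : hnu.unit = hnu'.unit := Units.ext (by simp [IsUnit.unit_spec])
      have hunits' : huZ.unit = hu.unit := Units.ext (by simp [IsUnit.unit_spec])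
      rw [hσn, hunits, hlamn, hunits']
    refine idealPow_natCast_eq_jacobiSym_mul e hd0 hd4 hn hnd hu hψ₀n ?_
    obtain ⟨u, huroot, hψu, hcongu⟩ := hψprinc (n : 𝓞 k) hn0 hnP hn𝔪
    refine ⟨u, huroot, hψu, ?_⟩
    rw [hχ'n, map_one] at hcongu
    rw [map_one]; exact hcongu
  · /- trace congruence -/
    intro ℓ hℓ hℓ2 hℓΔ
    haveI : Fact ℓ.Prime := ⟨hℓ⟩
    have hℓZ : Prime (ℓ : ℤ) := Nat.prime_iff_prime_int.mp hℓ
    have hℓΔZ : IsCoprime (ℓ : ℤ) Δ := (Prime.coprime_iff_not_dvd hℓZ).mpr hℓΔ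
    have hℓ2Z : IsCoprime (ℓ : ℤ) 2 := (Prime.coprime_iff_not_dvd hℓZ).mpr (by
      intro h
      have h' : ℓ ∣ 2 := by exact_mod_cast h
      exact hℓ2 ((Nat.prime_dvd_prime_iff_eq hℓ Nat.prime_two).mp h'))
    have hℓd₀Z : IsCoprime (ℓ : ℤ) d₀ := by rw [hd₀]; exact IsCoprime.mul_right hℓ2Z hℓΔZ
    have hℓtZ : IsCoprime (ℓ : ℤ) t := by
      rw [htdef]; exact IsCoprime.mul_right (hℓΔZ.of_isCoprime_of_dvd_right hdΔ) (hℓΔZ.pow_right)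
    have hunrk : Algebra.IsUnramifiedIn (𝓞 k) (Ideal.span {(ℓ : ℤ)}) :=
      (NumberField.not_dvd_discr_iff_isUnramifiedIn k (𝓞 k) hℓZ).mp fun h => hℓΔ (h.trans hdΔ)
    have hwT : ∀ w : HeightOneSpectrum (𝓞 k), ((ℓ : ℤ) : 𝓞 k) ∈ w.asIdeal → w ∉ T := fun w hw hwT =>
      copr_false w _ _ hℓd₀Z hw ((hmemT w).mp hwT)
    have hunrL : ∀ w : HeightOneSpectrum (𝓞 k), ((ℓ : ℤ) : 𝓞 k) ∈ w.asIdeal →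
        Algebra.IsUnramifiedIn (𝓞 L) w.asIdeal := fun w hw => hunr w (hwT w hw)
    have hcong : ∀ w : HeightOneSpectrum (𝓞 k), ((ℓ : ℤ) : 𝓞 k) ∈ w.asIdeal →
        ‖e.symm (ψ w) - e.symm ((χ' (galFrob k L w) : ℂˣ) : ℂ)‖ < 1 := by
      intro w hw
      have h1 : ¬ Ideal.span {((2 : ℕ) : 𝓞 k)} ≤ w.asIdeal := by
        rw [h2cast, Ideal.span_singleton_le_iff_mem]
        intro h2w
        exact copr_false w _ _ hℓ2Z hw (by exact_mod_cast h2w)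
      have h2 : ¬ 𝔪 ≤ w.asIdeal := by
        rw [h𝔪def, Ideal.span_singleton_le_iff_mem]
        intro htw
        exact copr_false w _ _ hℓtZ hw htw
      rw [← hψχ'val w (hwT w hw)]
      exact hψcong w h1 h2
    exact trace_congr L W ι hk2 h3 hKG hgen χ' hχ' e ψ hℓ2 hℓΔ hunrk hunrL hcong
end Summit.BirchSwinnertonDyer.BirchSwinnertonDyer.Theorems.HeckeThetaPartner
end
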